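import Mathlib
import Summits.ValiantsHypothesis.ValiantsHypothesis.Theorems.BarrierLeverDefinableEquationsPartialDerivativeWall

/-!
# Route BarrierLever — crux `DefinableEquations` (stmt-8745) / item `SingleSizeEquations`
# (stmt-8749): the partial-derivative wall WITH SHIFTS at high orders (val-np-p5 g10, sequel to
# `…PartialDerivativeWall.lean`)

`…PartialDerivativeWall.lean` §5 shows that at orders `⌊n/2⌋ ≤ e ≤ 2⌊n/2⌋` the quadric power
`Q_n = (x_1²+⋯+x_n²)^{⌊n/2⌋}` (linear complexity, a member of `SmallCircuits ℂ n b`, `b ≥ 2`,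
`n ≥ 3`) maximises the partial-derivative rank among homogeneous targets of degree `≤ 2⌊n/2⌋`.
Here the same is recorded for the SHIFTED partial derivative measure `rank g_{(e,D-e)[τ]}`
(`shiftedPartialsRank K e τ`, Kayal / Gupta–Kamath–Kayal–Saptharishi) at those orders and EVERY
shift `τ`: by Gesmundo–Landsberg's Case 1 (tree `monomial_mem_span_derivSet_sumSq_pow`) the shifted
partials of `Q_n` span all of `S^{2⌊n/2⌋-e+τ}`, the trivial ceiling for forms
(`shiftedPartialsRank_le_of_isHomogeneous`), whence `shiftedRank_le_shiftedRank_sumSq_pow_of_isHomogeneous`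
and the wall `no_shiftedRankMethod_smallCircuits_high`.

HONEST SCOPE: the LOW-order regime `e < n/2` with large shifts — the regime of the depth-four
lower bounds (GKKS 2014) — is NOT addressed: there `⟨∂^{=e} Q_n⟩_τ = q^{⌊n/2⌋-e}·S^{e+τ}` is far
from maximal, and no cheap polynomial with exactly maximal shifted-partial dimension is claimed.
What this is NOT: nothing on the crux (b = 2 OPEN) or on `VP ≠ VNP`.  No definitions, no named
facts, standard axioms.  Refs: Gesmundo–Landsberg, Theory Comput. 15 (2019) §4 (Case 1);
Forbes–Shpilka–Volk 2018 Def. 1/3.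
-/

-- `Summit.ValiantsHypothesis.ValiantsHypothesis.…` repeats a component by the D-0017 layout
-- (single-conjunct summit), which the `dupNamespace` linter flags; the name is mandated.
set_option linter.dupNamespace false

noncomputable section

namespace Summit.ValiantsHypothesis.ValiantsHypothesis.Theorems.BarrierLeverDefinableEquations

open MvPolynomial
open Literature.Computability.AlgebraicComplexity
open Literature.Barriers.ValiantsHypothesis
open scoped BigOperators

namespace PartialDerivativeWall

/-! ## SHIFTED partials at orders `≥ ⌊n/2⌋`: the same saturation for
every shift `τ` (Gesmundo–Landsberg's Case 1 with shifts); the LOW-order regime of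
Gupta–Kamath–Kayal–Saptharishi is NOT addressed -/

section HighOrdersShifted

variable {K : Type*} [Field K]

/-- Shifted partials of a FORM: `rank g_{(e,D-e)[τ]} ≤ binom(n + (D-e+τ) - 1, D-e+τ)` for homogeneous
`g` of degree `D` (its order-`e` derivatives shifted by degree-`τ` monomials are forms of degree
`D - e + τ`). [cite: GesmundoLandsberg2017, §4 (Case 1)] -/
theorem shiftedPartialsRank_le_of_isHomogeneous {n e τ D : ℕ} (g : MvPolynomial (Fin n) K)
    (hg : g.IsHomogeneous D) :
    shiftedPartialsRank K e τ g ≤ (n + (D - e + τ) - 1).choose (D - e + τ) := by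
  classical
  have h := shiftedPartialsRank_le_card_filter (Z := Finset.univ) hg (Finset.subset_univ _) e τ
  refine h.trans ?_
  calc (((Finset.univ : Finset (Fin n)).finsuppAntidiag (D - e + τ)).filter
          fun μ => D - e ≤ ∑ u ∈ (Finset.univ : Finset (Fin n)), μ u).card
      ≤ ((Finset.univ : Finset (Fin n)).finsuppAntidiag (D - e + τ)).card := Finset.card_filter_le _ _
    _ = (n + (D - e + τ) - 1).choose (D - e + τ) := by
        rw [Finset.card_finsuppAntidiag_nat_eq_choose, Finset.card_univ, Fintype.card_fin]

/-- Gesmundo–Landsberg's Case 1 with shifts for `Q_n`: for `n ≥ 1`, `⌊n/2⌋ ≤ e ≤ 2⌊n/2⌋` and every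
`τ`, the shifted partials `x^β ∂^α Q_n` (`|α| = e`, `|β| = τ`) span ALL of `S^{2⌊n/2⌋-e+τ}`, so
`rank (Q_n)_{(e,·)[τ]} ≥ binom(n + (2⌊n/2⌋-e+τ) - 1, 2⌊n/2⌋-e+τ)` (characteristic `0`).
[cite: GesmundoLandsberg2017, §4 (Case 1)] -/
theorem choose_le_shiftedPartialsRank_sumSq_pow {n e τ : ℕ} [CharZero K] (hn : 1 ≤ n)
    (hke : n / 2 ≤ e) (he : e ≤ 2 * (n / 2)) :
    (n + (2 * (n / 2) - e + τ) - 1).choose (2 * (n / 2) - e + τ) ≤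
      shiftedPartialsRank K e τ ((∑ j : Fin n, (X j : MvPolynomial (Fin n) K) ^ 2) ^ (n / 2)) := by
  classical
  have hq : (∑ j : Fin n, (X ((id : Fin n → Fin n) j) : MvPolynomial (Fin n) K) ^ 2) =
      ∑ j : Fin n, (X j : MvPolynomial (Fin n) K) ^ 2 := rfl
  have h := card_filter_le_shiftedPartialsRank (K := K) (Finset.univ : Finset (Fin n))
    (2 * (n / 2) - e) τ e ((∑ j : Fin n, (X j : MvPolynomial (Fin n) K) ^ 2) ^ (n / 2)) 1 one_ne_zero
    (fun γ hγ _ => by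
      rw [one_mul, ← hq]
      exact monomial_mem_span_derivSet_sumSq_pow (K := K) (v := (id : Fin n → Fin n))
        Function.injective_id (by omega) hke he γ hγ (by simp))
  refine le_trans (le_of_eq ?_) h
  rw [Finset.filter_true_of_mem, Finset.card_finsuppAntidiag_nat_eq_choose, Finset.card_univ,
    Fintype.card_fin]
  intro μ hμ
  rw [Finset.mem_finsuppAntidiag] at hμ
  rw [hμ.1]
  exact Nat.le_add_right _ _

/-- **Saturation of SHIFTED partials at high orders, homogeneous targets**: for `n ≥ 1`,
`⌊n/2⌋ ≤ e ≤ 2⌊n/2⌋`, every shift `τ` and every HOMOGENEOUS `g` of degree `D ≤ 2⌊n/2⌋`,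
`rank g_{(e,·)[τ]} ≤ rank (Q_n)_{(e,·)[τ]}` — the shifted-partials measure at these orders is
maximised by the quadric power of linear complexity.  (Low orders `e < n/2`, the regime of the
depth-four lower bounds, are NOT covered: there `⟨∂^{=e} Q_n⟩_τ = q^{⌊n/2⌋-e} S^{e+τ}` is far
from maximal.) [cite: GesmundoLandsberg2017, Thm. 4 and §4 (Case 1)] -/
theorem shiftedRank_le_shiftedRank_sumSq_pow_of_isHomogeneous {n e τ D : ℕ} [CharZero K]
    (hn : 1 ≤ n) (hke : n / 2 ≤ e) (he : e ≤ 2 * (n / 2)) (g : MvPolynomial (Fin n) K)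
    (hg : g.IsHomogeneous D) (hD : D ≤ 2 * (n / 2)) :
    shiftedPartialsRank K e τ g ≤
      shiftedPartialsRank K e τ ((∑ j : Fin n, (X j : MvPolynomial (Fin n) K) ^ 2) ^ (n / 2)) := by
  refine (shiftedPartialsRank_le_of_isHomogeneous g hg).trans
    (le_trans ?_ (choose_le_shiftedPartialsRank_sumSq_pow hn hke he))
  -- `m ↦ binom(n + m - 1, m) = binom(n + m - 1, n - 1)` is monotone in `m`
  have key : ∀ m : ℕ, (n + m - 1).choose m = (n + m - 1).choose (n - 1) := fun m => by
    have : n + m - 1 = m + (n - 1) := by omega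
    rw [this]; exact Nat.choose_symm_add
  rw [key, key]
  exact Nat.choose_le_choose _ (by omega)

/-- The shifted high-order wall (homogeneous targets): for `n ≥ 3`, `b ≥ 2`, `⌊n/2⌋ ≤ e ≤ 2⌊n/2⌋`,
any shift `τ`, no threshold `r` has `rank f_{(e,·)[τ]} < r` on `SmallCircuits ℂ n b` and
`rank g_{(e,·)[τ]} ≥ r` for some homogeneous `g` of degree `≤ 2⌊n/2⌋`.
[cite: ForbesShpilkaVolk2018, Cor. 5] -/
theorem no_shiftedRankMethod_smallCircuits_high {n b e τ : ℕ} (hn : 3 ≤ n) (hb : 2 ≤ b)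
    (hke : n / 2 ≤ e) (he : e ≤ 2 * (n / 2)) :
    ¬ ∃ r : ℕ, (∀ f ∈ SmallCircuits ℂ n b, shiftedPartialsRank ℂ e τ f < r) ∧
      ∃ (g : MvPolynomial (Fin n) ℂ) (D : ℕ), g.IsHomogeneous D ∧ D ≤ 2 * (n / 2) ∧
        r ≤ shiftedPartialsRank ℂ e τ g := by
  rintro ⟨r, hcls, g, D, hg, hD, hr⟩
  exact absurd ((shiftedRank_le_shiftedRank_sumSq_pow_of_isHomogeneous (by omega) hke he g hg
    hD).trans_lt (hcls _ (sumSq_pow_mem_smallCircuits hn hb))) (not_lt.2 hr)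

end HighOrdersShifted

end PartialDerivativeWall

end Summit.ValiantsHypothesis.ValiantsHypothesis.Theorems.BarrierLeverDefinableEquations
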